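import Summits.SmoothPoincare4.SmoothPoincare4.Theorems.ConvexBisectionAcyclicBisectionExistsDualLinkSeamPush
import HarnessLib

/-!
# Dual handles, T3c: transport of isotopies of framed links in `∂X` along the seam `∂X ≅ ∂W`
(brick (b), part 2, of the sub-goal T3c-3 `node_dualLink_pageLink` of stub `stub_steinRealisation`
(NF6), line `modp-braid-orbits` r11, crux `ConvexBisection.AcyclicBisectionExists`, item
stmt-SmoothPoincare4-10508; wave 3, lead c5; registered sub-goal `helper_linkIsotopy_seamTransport`)

Sequel of `…DualLinkSeamPush.lean` (the seam push `y ↦ (G y : W)` of knots and framings of `∂X`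
along a diffeomorphism `G : ∂X ≅ ∂W` of the canonical boundary carriers).  Here:

* §1 isotopies: an isotopy of knots / links all of whose stages lie in `∂X` is pushed to an isotopy
  in `∂W` (`exists_knotIsotopy_seamPush`, `exists_linkIsotopy_seamPush`: lift to `∂X` by
  `KnotIsotopyInBoundary.lift`, compose with `G` and `∂W ↪ W`), framing families carried along being
  pushed to framing families carried along, and homotopic framings to homotopic framings
  (`framingHomotopic_seamPush`);
* §2 the package `helper_linkIsotopy_seamTransport`: an isotopy of framed links in `∂X` (stages in
  `∂X` for `t ∈ [0, 1]`, first reparametrised by `LinkIsotopyInBoundary.reparam`) is carried by `G` to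
  an isotopy of framed links in `∂W` between the pushed end links, the framings being pushed by the
  differential of `y ↦ (G y : W)` (re-indexing of isotopies by propositionally equal ends:
  `exists_linkIsotopy_of_eq`, `isFramingAlong_of_toFun_eq`).  No `def`: the isotopies are produced
  existentially, with their stages named.

Everything is proved; no named facts, no `sorry`.

## References
* A. A. Kosinski, *Differential Manifolds* (1993), VI §6 and VIII, proof of (1.2). [Kosinski1993]
* J. Milnor, *Lectures on the h-cobordism theorem* (1965), §3 (dual handles). [MilnorHCobordism1965]
-/

noncomputable section

-- the prescribed namespace `Summit.<P>.<Sub>.…` duplicates `SmoothPoincare4` (P = Sub)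
set_option linter.dupNamespace false

open scoped Manifold ContDiff Topology

namespace Summit.SmoothPoincare4.SmoothPoincare4.Theorems.AcyclicBisectionExists.ModpBraidOrbits

open Set Function Filter Metric Topology Bundle
open Literature.Topology.FourManifolds Literature.Topology.FourManifolds.HandleAttachingMap
  Literature.Topology.FourManifolds.BoundaryManifold Literature.Geometry.Symplectic

/-! ## §1 The seam push of isotopies of knots and links, and of framing families -/

section SeamPush

variable {X : Type} [TopologicalSpace X] [T2Space X] [ChartedSpace (EuclideanHalfSpace 4) X]
  [IsManifold (𝓡∂ 4) ∞ X]
  {W : Type} [TopologicalSpace W] [ChartedSpace (EuclideanHalfSpace 4) W] [IsManifold (𝓡∂ 4) ∞ W]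
  (G : (BoundaryManifold.boundaryData 3 X).carrier ≃ₘ⟮𝓡 3, 𝓡 3⟯
    (BoundaryManifold.boundaryData 3 W).carrier)

/-- **The seam push of an isotopy of knots all of whose stages lie in `∂X`**: an isotopy of knots
in `∂W` with stages `t ↦ (G ∘ lift of the stage : 𝕊¹ → W)`, along which every framing family carried
along the given isotopy is pushed (by the differential of `y ↦ (G y : W)`, after taking tails) to a
framing family carried along. [cite: Kosinski1993, VIII proof of (1.2)] -/
theorem exists_knotIsotopy_seamPush {K K' : sphere (0 : EuclideanSpace ℝ (Fin 2)) 1 → X}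
    (Φ : KnotIsotopyInBoundary K K') (hB : ∀ t u, (𝓡∂ 4).IsBoundaryPoint (Φ.toFun t u)) :
    ∃ Φ' : KnotIsotopyInBoundary
        (fun u => (BoundaryManifold.boundaryData 3 W).incl (G (knotLift (Φ.isBoundaryKnot_of_forall hB 0) u)))
        (fun u => (BoundaryManifold.boundaryData 3 W).incl (G (knotLift (Φ.isBoundaryKnot_of_forall hB 1) u))),
      (∀ t, Φ'.toFun t = fun u =>
        (BoundaryManifold.boundaryData 3 W).incl (G (knotLift (Φ.isBoundaryKnot_of_forall hB t) u))) ∧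
      ∀ (ν : sphere (0 : EuclideanSpace ℝ (Fin 2)) 1 → EuclideanSpace ℝ (Fin 4))
        (νt : ℝ → sphere (0 : EuclideanSpace ℝ (Fin 2)) 1 → EuclideanSpace ℝ (Fin 4)),
        IsFramingAlong Φ ν νt →
        IsFramingAlong Φ'
          (fun u => mfderiv (𝓡 3) (𝓡∂ 4) (fun y => (BoundaryManifold.boundaryData 3 W).incl (G y))
            (knotLift (Φ.isBoundaryKnot_of_forall hB 0) u) (tail 3 (ν u)))
          fun t u => mfderiv (𝓡 3) (𝓡∂ 4) (fun y => (BoundaryManifold.boundaryData 3 W).incl (G y))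
            (knotLift (Φ.isBoundaryKnot_of_forall hB t) u) (tail 3 (νt t u)) := by
  refine ⟨{ toFun := fun t u => (BoundaryManifold.boundaryData 3 W).incl (G ((Φ.lift hB).toFun t u))
            contMDiff := (contMDiff_seamPush G).comp (Φ.lift hB).contMDiff
            isSmoothEmbedding := fun t =>
              (isBoundaryKnot_seamPush G (Φ.isBoundaryKnot_of_forall hB t)).isSmoothEmbedding
            map_zero := rfl
            map_one := rfl
            isBoundaryPoint := fun _ _ _ => (BoundaryManifold.boundaryData 3 W).incl_mem_boundary _ },
    fun t => rfl, fun ν νt h => ⟨?_, fun t ht => ?_, ?_⟩⟩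
  · funext u
    show mfderiv (𝓡 3) (𝓡∂ 4) (fun y => (BoundaryManifold.boundaryData 3 W).incl (G y))
      (knotLift (Φ.isBoundaryKnot_of_forall hB 0) u) (tail 3 (νt 0 u)) = _
    rw [h.apply_zero]
  · exact isKnotFraming_seamPush G (Φ.isBoundaryKnot_of_forall hB t) (h.isKnotFraming t ht)
  · have h1 := continuousOn_totalSpace_tail
      (G := fun p : ℝ × sphere (0 : EuclideanSpace ℝ (Fin 2)) 1 =>
        knotLift (Φ.isBoundaryKnot_of_forall hB p.1) p.2)
      (σ := fun p => νt p.1 p.2) (R := Icc (0 : ℝ) 1 ×ˢ univ)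
      (fun p hp => (h.isKnotFraming p.1 hp.1).mem_boundaryTangentSpace p.2) h.continuousOn
    exact continuousOn_totalSpace_mfderiv (contMDiff_seamPush G) h1

/-- **The seam push of an isotopy of links all of whose stages lie in `∂X`** (componentwise; the
stages stay disjoint because the seam push is injective), with the push of the framing families
carried along its components. [cite: Kosinski1993, VIII proof of (1.2)] -/
theorem exists_linkIsotopy_seamPush {ι : Type*} {L L' : ι → sphere (0 : EuclideanSpace ℝ (Fin 2)) 1 → X}
    (Φ : LinkIsotopyInBoundary L L') (hB : ∀ i t u, (𝓡∂ 4).IsBoundaryPoint ((Φ.isotopy i).toFun t u)) :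
    ∃ Φ' : LinkIsotopyInBoundary
        (fun i u => (BoundaryManifold.boundaryData 3 W).incl
          (G (knotLift ((Φ.isotopy i).isBoundaryKnot_of_forall (hB i) 0) u)))
        (fun i u => (BoundaryManifold.boundaryData 3 W).incl
          (G (knotLift ((Φ.isotopy i).isBoundaryKnot_of_forall (hB i) 1) u))),
      (∀ i t, (Φ'.isotopy i).toFun t = fun u => (BoundaryManifold.boundaryData 3 W).incl
        (G (knotLift ((Φ.isotopy i).isBoundaryKnot_of_forall (hB i) t) u))) ∧
      ∀ (i : ι) (ν : sphere (0 : EuclideanSpace ℝ (Fin 2)) 1 → EuclideanSpace ℝ (Fin 4))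
        (νt : ℝ → sphere (0 : EuclideanSpace ℝ (Fin 2)) 1 → EuclideanSpace ℝ (Fin 4)),
        IsFramingAlong (Φ.isotopy i) ν νt →
        IsFramingAlong (Φ'.isotopy i)
          (fun u => mfderiv (𝓡 3) (𝓡∂ 4) (fun y => (BoundaryManifold.boundaryData 3 W).incl (G y))
            (knotLift ((Φ.isotopy i).isBoundaryKnot_of_forall (hB i) 0) u) (tail 3 (ν u)))
          fun t u => mfderiv (𝓡 3) (𝓡∂ 4) (fun y => (BoundaryManifold.boundaryData 3 W).incl (G y))
            (knotLift ((Φ.isotopy i).isBoundaryKnot_of_forall (hB i) t) u) (tail 3 (νt t u)) := by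
  choose Φ' hΦ' hfr using fun i => exists_knotIsotopy_seamPush G (Φ.isotopy i) (hB i)
  refine ⟨⟨Φ', fun t ht i j hij => ?_⟩, hΦ', hfr⟩
  show Disjoint (range ((Φ' i).toFun t)) (range ((Φ' j).toFun t))
  rw [hΦ' i t, hΦ' j t]
  refine Set.disjoint_left.2 ?_
  rintro _ ⟨u, rfl⟩ ⟨u', hu'⟩
  have h1 := injective_seamPush G hu'
  have h2 : (Φ.isotopy j).toFun t u' = (Φ.isotopy i).toFun t u := congrArg Subtype.val h1
  exact Set.disjoint_left.1 (Φ.disjoint t ht hij) ⟨u, rfl⟩ ⟨u', h2⟩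

/-- **Homotopic framings are pushed to homotopic framings** (the push of the homotopy along the
constant isotopy). [folklore] -/
theorem framingHomotopic_seamPush {K : sphere (0 : EuclideanSpace ℝ (Fin 2)) 1 → X}
    {ν ν' : sphere (0 : EuclideanSpace ℝ (Fin 2)) 1 → EuclideanSpace ℝ (Fin 4)}
    (h : FramingHomotopic K ν ν') (hK : IsBoundaryKnot K) :
    FramingHomotopic (fun u => (BoundaryManifold.boundaryData 3 W).incl (G (knotLift hK u)))
      (fun u => mfderiv (𝓡 3) (𝓡∂ 4) (fun y => (BoundaryManifold.boundaryData 3 W).incl (G y))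
        (knotLift hK u) (tail 3 (ν u)))
      (fun u => mfderiv (𝓡 3) (𝓡∂ 4) (fun y => (BoundaryManifold.boundaryData 3 W).incl (G y))
        (knotLift hK u) (tail 3 (ν' u))) := by
  obtain ⟨hK', νt, hνt, rfl⟩ := h
  have hB : ∀ t u, (𝓡∂ 4).IsBoundaryPoint ((KnotIsotopyInBoundary.refl hK').toFun t u) :=
    fun _ u => hK'.isBoundaryPoint u
  obtain ⟨Φ', hΦ', hfr⟩ := exists_knotIsotopy_seamPush G (KnotIsotopyInBoundary.refl hK') hB
  have h1 := hfr _ _ hνt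
  refine ⟨isBoundaryKnot_seamPush G hK, fun t u =>
    mfderiv (𝓡 3) (𝓡∂ 4) (fun y => (BoundaryManifold.boundaryData 3 W).incl (G y))
      (knotLift ((KnotIsotopyInBoundary.refl hK').isBoundaryKnot_of_forall hB t) u) (tail 3 (νt t u)),
    ⟨h1.apply_zero, fun t ht => ?_, ?_⟩, rfl⟩
  · have h2 := h1.isKnotFraming t ht
    rw [hΦ' t] at h2
    exact h2
  · refine h1.continuousOn.congr fun p _ => ?_
    show (TotalSpace.mk' (EuclideanSpace ℝ (Fin 4)) ((KnotIsotopyInBoundary.refl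
        (isBoundaryKnot_seamPush G hK)).toFun p.1 p.2) _ : TangentBundle (𝓡∂ 4) W) =
      TotalSpace.mk' (EuclideanSpace ℝ (Fin 4)) (Φ'.toFun p.1 p.2) _
    rw [hΦ' p.1]
    rfl

end SeamPush

/-! ## §2 The package: transport of isotopies of framed links along the seam -/

section Package

variable {X : Type} [TopologicalSpace X] [ChartedSpace (EuclideanHalfSpace 4) X]

/-- **Re-indexing an isotopy of links by propositionally equal end links** (same stages). [folklore] -/
theorem exists_linkIsotopy_of_eq {ι : Type*} {L L' M M' : ι → sphere (0 : EuclideanSpace ℝ (Fin 2)) 1 → X}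
    (Φ : LinkIsotopyInBoundary L L') (hL : L = M) (hL' : L' = M') :
    ∃ Ψ : LinkIsotopyInBoundary M M', ∀ i t, (Ψ.isotopy i).toFun t = (Φ.isotopy i).toFun t := by
  subst hL hL'
  exact ⟨Φ, fun _ _ => rfl⟩

variable [IsManifold (𝓡∂ 4) ∞ X]

/-- A framing family along an isotopy is a framing family along any isotopy with the same stages.
[folklore] -/
theorem isFramingAlong_of_toFun_eq {K K' L L' : sphere (0 : EuclideanSpace ℝ (Fin 2)) 1 → X}
    {Φ : KnotIsotopyInBoundary K K'} {Ψ : KnotIsotopyInBoundary L L'}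
    {ν : sphere (0 : EuclideanSpace ℝ (Fin 2)) 1 → EuclideanSpace ℝ (Fin 4)}
    {νt : ℝ → sphere (0 : EuclideanSpace ℝ (Fin 2)) 1 → EuclideanSpace ℝ (Fin 4)}
    (h : IsFramingAlong Φ ν νt) (e : ∀ t, Ψ.toFun t = Φ.toFun t) : IsFramingAlong Ψ ν νt where
  apply_zero := h.apply_zero
  isKnotFraming t ht := by rw [e t]; exact h.isKnotFraming t ht
  continuousOn := by
    refine h.continuousOn.congr fun p _ => ?_
    show (TotalSpace.mk' (EuclideanSpace ℝ (Fin 4)) (Ψ.toFun p.1 p.2) (νt p.1 p.2) :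
      TangentBundle (𝓡∂ 4) X) = TotalSpace.mk' (EuclideanSpace ℝ (Fin 4)) (Φ.toFun p.1 p.2) (νt p.1 p.2)
    rw [e p.1]

/-- **Sub-goal `helper_linkIsotopy_seamTransport` of stub `stub_steinRealisation`** (NF6 ▸ T3 ▸ T3c-3,
brick (b); wave 3, lead c5): **transport of an isotopy of framed links in `∂X` along a seam
diffeomorphism `G : ∂X ≅ ∂W` of the canonical boundary carriers.**  Given an isotopy `Φ` of links in
`∂X` (stages `t ∈ [0, 1]` in `∂X`, pairwise disjoint) from `L` to `L'` and framing families `νt i`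
carried along its components from `ν i`: the end links lie in `∂X`, and there are an isotopy of
links in `∂W` from the pushed link `u ↦ G ⟨L i u, _⟩` to `u ↦ G ⟨L' i u, _⟩` and framing families
along it from the pushed framings `d(G)(tail (ν i u))` ending at the pushed end framings
`d(G)(tail (νt i 1 u))` (`tail` drops the normal coordinate of a vector tangent to `∂X`; the push is
by the differential of `y ↦ (G y : W)`).  Proof: reparametrise so that all stages lie in `∂X`
(`LinkIsotopyInBoundary.reparam`), lift to `∂X`, compose with `G` and `∂W ↪ W` (§2).
[cite: Kosinski1993, VI §6 and VIII proof of (1.2)] -/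
theorem helper_linkIsotopy_seamTransport : ∀ {X : Type} [TopologicalSpace X] [T2Space X] [ChartedSpace (EuclideanHalfSpace 4) X] [IsManifold (𝓡∂ 4) ∞ X] {W : Type} [TopologicalSpace W] [ChartedSpace (EuclideanHalfSpace 4) W] [IsManifold (𝓡∂ 4) ∞ W] (G : (Literature.Topology.FourManifolds.BoundaryManifold.boundaryData 3 X).carrier ≃ₘ⟮𝓡 3, 𝓡 3⟯ (Literature.Topology.FourManifolds.BoundaryManifold.boundaryData 3 W).carrier) {ι : Type} (L L' : ι → Metric.sphere (0 : EuclideanSpace ℝ (Fin 2)) 1 → X) (Φ : Literature.Geometry.Symplectic.LinkIsotopyInBoundary L L') (ν : ι → Metric.sphere (0 : EuclideanSpace ℝ (Fin 2)) 1 → EuclideanSpace ℝ (Fin 4)) (νt : ι → ℝ → Metric.sphere (0 : EuclideanSpace ℝ (Fin 2)) 1 → EuclideanSpace ℝ (Fin 4)), (∀ i, Literature.Geometry.Symplectic.IsFramingAlong (Φ.isotopy i) (ν i) (νt i)) → ∃ (hL : ∀ i u, L i u ∈ (𝓡∂ 4).boundary X) (hL' : ∀ i u, L' i u ∈ (𝓡∂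 4).boundary X) (Φ' : Literature.Geometry.Symplectic.LinkIsotopyInBoundary (fun i u => (Literature.Topology.FourManifolds.BoundaryManifold.boundaryData 3 W).incl (G ⟨L i u, hL i u⟩)) (fun i u => (Literature.Topology.FourManifolds.BoundaryManifold.boundaryData 3 W).incl (G ⟨L' i u, hL' i u⟩))) (νt' : ι → ℝ → Metric.sphere (0 : EuclideanSpace ℝ (Fin 2)) 1 → EuclideanSpace ℝ (Fin 4)), (∀ i, Literature.Geometry.Symplectic.IsFramingAlong (Φ'.isotopy i) (fun u => mfderiv (𝓡 3) (𝓡∂ 4) (fun y => (Literature.Topology.FourManifolds.BoundaryManifold.boundaryData 3 W).incl (G y)) ⟨L i u, hL i u⟩ (Literature.Topology.FourManifolds.BoundaryManifold.tail 3 (ν i u))) (νt' i)) ∧ (∀ i u, νt' i 1 u = mfderiv (𝓡 3) (𝓡∂ 4) (fun y => (Literature.Topology.FourManifolds.BoundaryManifold.boundaryData 3 W).incl (G y)) ⟨L' i u, hL' i u⟩ (Literature.Topology.FourManifolds.BoundaryManifold.tail 3 (νt i 1 u))) := by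
  intro X _ _ _ _ W _ _ _ G ι L L' Φ ν νt hν
  -- reparametrise: all stages in `∂X`
  have hB : ∀ i t u, (𝓡∂ 4).IsBoundaryPoint ((Φ.reparam.isotopy i).toFun t u) := fun i t u =>
    (Φ.isotopy i).isBoundaryPoint_reparam t u
  have hν' : ∀ i, IsFramingAlong (Φ.reparam.isotopy i) (ν i) fun t => νt i (Real.smoothTransition t) :=
    fun i => (hν i).reparam
  have hL : ∀ i u, L i u ∈ (𝓡∂ 4).boundary X := fun i u => by
    have h := hB i 0 u
    rwa [(Φ.reparam.isotopy i).map_zero] at h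
  have hL' : ∀ i u, L' i u ∈ (𝓡∂ 4).boundary X := fun i u => by
    have h := hB i 1 u
    rwa [(Φ.reparam.isotopy i).map_one] at h
  -- push, then re-index the end knots
  obtain ⟨Θ, hΘ, hfr⟩ := exists_linkIsotopy_seamPush G Φ.reparam hB
  have e0 : ∀ i u, knotLift ((Φ.reparam.isotopy i).isBoundaryKnot_of_forall (hB i) 0) u = ⟨L i u, hL i u⟩ :=
    fun i u => Subtype.ext (congrFun ((Φ.reparam.isotopy i).map_zero) u)
  have e1 : ∀ i u, knotLift ((Φ.reparam.isotopy i).isBoundaryKnot_of_forall (hB i) 1) u = ⟨L' i u, hL' i u⟩ :=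
    fun i u => Subtype.ext (congrFun ((Φ.reparam.isotopy i).map_one) u)
  obtain ⟨Φ', hΦ'⟩ := exists_linkIsotopy_of_eq
    (M := fun i u => (BoundaryManifold.boundaryData 3 W).incl (G ⟨L i u, hL i u⟩))
    (M' := fun i u => (BoundaryManifold.boundaryData 3 W).incl (G ⟨L' i u, hL' i u⟩)) Θ
    (funext fun i => funext fun u => by show _ = (BoundaryManifold.boundaryData 3 W).incl (G ⟨L i u, hL i u⟩); rw [← e0 i u])
    (funext fun i => funext fun u => by show _ = (BoundaryManifold.boundaryData 3 W).incl (G ⟨L' i u, hL' i u⟩); rw [← e1 i u])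
  refine ⟨hL, hL', Φ', fun i t u =>
    mfderiv (𝓡 3) (𝓡∂ 4) (fun y => (BoundaryManifold.boundaryData 3 W).incl (G y))
      (knotLift ((Φ.reparam.isotopy i).isBoundaryKnot_of_forall (hB i) t) u)
      (tail 3 (νt i (Real.smoothTransition t) u)), fun i => ?_, fun i u => ?_⟩
  · have h1 := hfr i _ _ (hν' i)
    have h2 : (fun u => mfderiv (𝓡 3) (𝓡∂ 4) (fun y => (BoundaryManifold.boundaryData 3 W).incl (G y))
        (knotLift ((Φ.reparam.isotopy i).isBoundaryKnot_of_forall (hB i) 0) u) (tail 3 (ν i u))) =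
        fun u => mfderiv (𝓡 3) (𝓡∂ 4) (fun y => (BoundaryManifold.boundaryData 3 W).incl (G y))
          ⟨L i u, hL i u⟩ (tail 3 (ν i u)) := by
      funext u
      rw [e0 i u]
    rw [h2] at h1
    exact isFramingAlong_of_toFun_eq h1 (hΦ' i)
  · show mfderiv (𝓡 3) (𝓡∂ 4) (fun y => (BoundaryManifold.boundaryData 3 W).incl (G y))
      (knotLift ((Φ.reparam.isotopy i).isBoundaryKnot_of_forall (hB i) 1) u)
      (tail 3 (νt i (Real.smoothTransition 1) u)) = _
    rw [e1 i u, Real.smoothTransition.one]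

end Package

end Summit.SmoothPoincare4.SmoothPoincare4.Theorems.AcyclicBisectionExists.ModpBraidOrbits

end
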